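import Mathlib
import Summits.MatrixMultiplication.MatrixMultiplication.Theorems.SubgroupIdentityDesigns.Negative.TorusCube

/-!
# Root-smear obstruction for level-`k` identity tests (negative lemma, crux `SubgroupIdentityDesigns`, 14079)

Level `k` on `M_m(𝔽_p)`: `f = Σ_{rk M ≤ k} c_M ψ(tr(M·))` (`fourierMat`).  Fix `k ≤ i < j < m` (0-indexed) and the
closed pattern
`Π = {(a,b) : b < a < k} ∪ ({i,j} × {b : b < k}) ∪ {(i,j)}`
(the strictly lower part of the top-left `k × k` block, rows `i` and `j` on the first `k` columns, and the root
position `(i,j)`), with pattern group `Q = 1 + 𝔫_Π` (`|Q| = p^{k(k-1)/2+2k+1}`), and the linear form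
`ℓ(n) = Σ_{1 ≤ s < k} n_{s,s-1} + n_{j,k-1} + n_{i,j}` (the `ℓ`-POSITIONS `ellPos`; all of them are simple
positions of `Π`, so `ψ ∘ ℓ` is a linear character of `Q`).
* `rootSmear_sum_eq_zero`: for every `M` of rank `≤ k`, `Σ_e ψ(ℓ(n_e)) ψ(tr(M (1 + n_e))) = 0`
  (`e` runs over all matrices and `n_e` reads only the pattern entries, so each point of `Q` is counted
  `p^{m² − |Π|}` times).  Fourier proof: the sum factorises over the pattern entries as
  `ψ(tr M) · Π_{(a,b) ∈ Π} p·[M_{ba} = −ε_{ab}]` (`ε = 1` on `ℓ`-positions, `0` elsewhere); on the support the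
  `(k+1) × (k+1)` submatrix of `M` with rows `(0,…,k-1,j)` and columns `(1,…,k-1,j,i)` is lower triangular
  with diagonal `−1`, so `rk M ≥ k+1`.
* `no_idTest_of_rootSmear`: hence no level-`k` function is `1` at `1` and `0` on the rest of a set
  `S ⊆ M_m(𝔽_p)` containing `Q` — in particular (`Negative.RootSmearDesign.no_levelK_design_of_rootSmear`,
  the companion file) no subgroup triple
  `(H₁, H₂, H₃)` of `GL_m(𝔽_p)` with the unipotents of pattern `Π ∖ {(i,j)}` in `H₁` and the root subgroup
  `X_{ij}` in `H₂` passes the crux's level-`k` identity test, for ANY `H₃`, any prime `p` and any `m ≥ k+2`: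
  ONE root subgroup in the middle group against a first-`k`-columns unipotent kills every level-`k` design
  (this needs neither TPP, nor `3k ≤ m` as `cornerSlice`, nor tori as `TorusCube`, and it holds at `p = 2`).
  It kills the Borel template of the card `borel-configuration-identity-test` at every `k`, and explains the
  certified non-separation of the `GL_4(𝔽_2)` `k = 2` skeleton (unique 64-term `±1` dependency
  `(−1)^{q₂₁+q₄₂+q₃₄}`; cell B2b-5, `run/shared/lean/b2b/levelgraded-cu/ORACLE.md` §5).
Sorry-free; standard axioms.
-/

set_option linter.dupNamespace false

noncomputable section

open scoped BigOperators Classical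

namespace Summit.MatrixMultiplication.MatrixMultiplication.Theorems.SubgroupIdentityDesigns.Negative

variable {p m : ℕ} [Fact p.Prime]

/-- The root-smear pattern `Π(k,i,j)` as a set of positions `(a, b)`. -/
def smearPat (k : ℕ) (i j : Fin m) : Finset (Fin m × Fin m) :=
  Finset.univ.filter fun ab =>
    (ab.2.val < ab.1.val ∧ ab.1.val < k) ∨ ((ab.1 = i ∨ ab.1 = j) ∧ ab.2.val < k) ∨ (ab.1 = i ∧ ab.2 = j)

/-- The `ℓ`-positions: `(s, s-1)` for `1 ≤ s < k`, `(j, k-1)`, `(i, j)`. -/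
def ellPos (k : ℕ) (i j : Fin m) : Finset (Fin m × Fin m) :=
  Finset.univ.filter fun ab =>
    (ab.2.val + 1 = ab.1.val ∧ ab.1.val < k) ∨ (ab.1 = j ∧ ab.2.val + 1 = k) ∨ (ab.1 = i ∧ ab.2 = j)

/-- Unfolding membership in the pattern `Π(k,i,j)`. -/
theorem mem_smearPat {k : ℕ} {i j a b : Fin m} : (a, b) ∈ smearPat k i j ↔
    (b.val < a.val ∧ a.val < k) ∨ ((a = i ∨ a = j) ∧ b.val < k) ∨ (a = i ∧ b = j) := by
  simp [smearPat]

/-- Unfolding membership in the set of `ℓ`-positions. -/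
theorem mem_ellPos {k : ℕ} {i j a b : Fin m} : (a, b) ∈ ellPos k i j ↔
    (b.val + 1 = a.val ∧ a.val < k) ∨ (a = j ∧ b.val + 1 = k) ∨ (a = i ∧ b = j) := by
  simp [ellPos]

/-- The pattern entries read off `e` (else `0`): the nilpotent part `n_e` of the point `1 + n_e ∈ Q`. -/
def smearNil (k : ℕ) (i j : Fin m) (e : CMat p m) : CMat p m :=
  Matrix.of fun a b => if (a, b) ∈ smearPat k i j then e a b else 0

/-- The indicator weight `ε_{ab}` of the `ℓ`-positions. -/
def smearEps (k : ℕ) (i j a b : Fin m) : ZMod p :=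
  if (a, b) ∈ ellPos k i j then 1 else 0

/-- `ℓ(n_e)`, written with the outer index the column: `Σ_a Σ_b [ellPos (b,a)] e b a`. -/
def smearEll (k : ℕ) (i j : Fin m) (e : CMat p m) : ZMod p :=
  ∑ a : Fin m, ∑ b : Fin m, if (b, a) ∈ ellPos k i j then e b a else 0

/-- Every `ℓ`-position is a pattern position. -/
theorem ellPos_imp_smearPat {k : ℕ} {i j a b : Fin m} (h : (a, b) ∈ ellPos k i j) :
    (a, b) ∈ smearPat k i j := by
  rw [mem_ellPos] at h
  rw [mem_smearPat]
  rcases h with ⟨h1, h2⟩ | ⟨h1, h2⟩ | ⟨h1, h2⟩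
  · exact Or.inl ⟨by omega, h2⟩
  · exact Or.inr (Or.inl ⟨Or.inr h1, by omega⟩)
  · exact Or.inr (Or.inr ⟨h1, h2⟩)

/-- The trace of `M (1 + n_e)`: `tr M` plus the pattern entries. -/
theorem trace_mul_one_add_smearNil (k : ℕ) (i j : Fin m) (e M : CMat p m) :
    Matrix.trace (M * (1 + smearNil k i j e)) =
      (∑ a : Fin m, M a a) +
        ∑ a : Fin m, ∑ b : Fin m, (if (b, a) ∈ smearPat k i j then M a b * e b a else 0) := by
  rw [Matrix.mul_add, Matrix.mul_one, Matrix.trace_add]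
  congr 1
  simp only [Matrix.trace, Matrix.diag_apply, Matrix.mul_apply, smearNil, Matrix.of_apply]
  refine Finset.sum_congr rfl fun a _ => Finset.sum_congr rfl fun b _ => ?_
  split_ifs <;> simp

/-- The twisted phase of one point factorises over the pattern entries. -/
theorem smear_phase (k : ℕ) (i j : Fin m) (e M : CMat p m) :
    ZMod.stdAddChar (smearEll k i j e) * ZMod.stdAddChar (Matrix.trace (M * (1 + smearNil k i j e))) =
      ZMod.stdAddChar (∑ a : Fin m, M a a) *
        ∏ a : Fin m, ∏ b : Fin m,
          ZMod.stdAddChar (if (b, a) ∈ smearPat k i j then (M a b + smearEps k i j b a) * e b a else 0) := by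
  have hsum : smearEll k i j e + ∑ a : Fin m, ∑ b : Fin m, (if (b, a) ∈ smearPat k i j then M a b * e b a else 0)
      = ∑ a : Fin m, ∑ b : Fin m,
          (if (b, a) ∈ smearPat k i j then (M a b + smearEps k i j b a) * e b a else 0) := by
    unfold smearEll
    rw [← Finset.sum_add_distrib]
    refine Finset.sum_congr rfl fun a _ => ?_
    rw [← Finset.sum_add_distrib]
    refine Finset.sum_congr rfl fun b _ => ?_
    unfold smearEps
    by_cases hl : (b, a) ∈ ellPos k i j
    · rw [if_pos hl, if_pos (ellPos_imp_smearPat hl), if_pos (ellPos_imp_smearPat hl), if_pos hl]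
      ring
    · rw [if_neg hl, if_neg hl, zero_add]
      split_ifs <;> ring
  rw [trace_mul_one_add_smearNil, AddChar.map_add_eq_mul, mul_left_comm, ← AddChar.map_add_eq_mul, hsum]
  congr 1
  rw [stdAddChar_map_sum]
  exact Finset.prod_congr rfl fun a _ => stdAddChar_map_sum (p := p) Finset.univ
    (fun b => if (b, a) ∈ smearPat k i j then (M a b + smearEps k i j b a) * e b a else 0)

/-- **Summing over the pattern group**: `Σ_e ψ(ℓ(n_e)) ψ(tr(M(1+n_e))) = ψ(tr M) · Π_{(b,a)} w_{ab}` with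
`w = p·[M_ab + ε_ba = 0]` on pattern positions `(b,a)` and `w = p` elsewhere. -/
theorem sum_smear_phase (k : ℕ) (i j : Fin m) (M : CMat p m) :
    ∑ e : CMat p m, ZMod.stdAddChar (smearEll k i j e) *
        ZMod.stdAddChar (Matrix.trace (M * (1 + smearNil k i j e))) =
      ZMod.stdAddChar (∑ a : Fin m, M a a) *
        ∏ a : Fin m, ∏ b : Fin m,
          (if (b, a) ∈ smearPat k i j then (if M a b + smearEps k i j b a = 0 then (p : ℂ) else 0) else (p : ℂ)) := by
  simp_rw [smear_phase]
  rw [← Finset.mul_sum]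
  congr 1
  set G : Fin m → Fin m → ZMod p → ℂ := fun a b x =>
    ZMod.stdAddChar (if (b, a) ∈ smearPat k i j then (M a b + smearEps k i j b a) * x else 0) with hG
  have hswap : (∑ e : CMat p m, ∏ a : Fin m, ∏ b : Fin m, G a b (e b a)) =
      ∏ a : Fin m, ∏ b : Fin m, ∑ x : ZMod p, G a b x := by
    calc (∑ e : CMat p m, ∏ a : Fin m, ∏ b : Fin m, G a b (e b a))
        = ∑ e : CMat p m, ∏ b : Fin m, ∏ a : Fin m, G a b (e b a) := by
          refine Finset.sum_congr rfl fun e _ => Finset.prod_comm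
      _ = ∑ f : Fin m → Fin m → ZMod p, ∏ b : Fin m, ∏ a : Fin m, G a b (f b a) := by
          rw [← Equiv.sum_comp Matrix.of]
          rfl
      _ = ∏ b : Fin m, ∑ g : Fin m → ZMod p, ∏ a : Fin m, G a b (g a) :=
          (Fintype.prod_sum (fun b (g : Fin m → ZMod p) => ∏ a : Fin m, G a b (g a))).symm
      _ = ∏ b : Fin m, ∏ a : Fin m, ∑ x : ZMod p, G a b x := by
          refine Finset.prod_congr rfl fun b _ => ?_
          exact (Fintype.prod_sum (fun a (x : ZMod p) => G a b x)).symm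
      _ = _ := Finset.prod_comm
  have hG' : ∀ (e : CMat p m) (a b : Fin m),
      ZMod.stdAddChar (if (b, a) ∈ smearPat k i j then (M a b + smearEps k i j b a) * e b a else 0) = G a b (e b a) :=
    fun e a b => rfl
  simp_rw [hG']
  rw [hswap]
  refine Finset.prod_congr rfl fun a _ => Finset.prod_congr rfl fun b _ => ?_
  by_cases hc : (b, a) ∈ smearPat k i j
  · simp only [hG, if_pos hc]
    rw [sum_psi_mul]
  · simp only [hG, if_neg hc, AddChar.map_zero_eq_one, Finset.sum_const, Finset.card_univ, ZMod.card,
      nsmul_eq_mul, mul_one]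

/-- The rank step: if `M_{ab} = −ε_{ba}` at every pattern position `(b,a)`, then `rk M ≥ k + 1`
(the submatrix rows `(0,…,k-1,j)` × columns `(1,…,k-1,j,i)` is lower triangular with diagonal `−1`). -/
theorem succ_le_rank_of_smear_entries (k : ℕ) (i j : Fin m) (hki : k ≤ i.val) (hij : i.val < j.val)
    (M : CMat p m) (hent : ∀ a b : Fin m, (b, a) ∈ smearPat k i j → M a b = -smearEps k i j b a) :
    k + 1 ≤ M.rank := by
  have hij' : i ≠ j := fun h => by rw [h] at hij; exact lt_irrefl _ hij
  have hjm : j.val < m := j.isLt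
  -- index maps of the `(k+1) × (k+1)` minor
  let row : Fin (k + 1) → Fin m := fun r => if h : r.val < k then ⟨r.val, by omega⟩ else j
  let col : Fin (k + 1) → Fin m := fun c =>
    if h : c.val + 1 < k then ⟨c.val + 1, by omega⟩ else if c.val + 1 = k then j else i
  let S : Matrix (Fin (k + 1)) (Fin (k + 1)) (ZMod p) := M.submatrix row col
  -- its entries on and above the diagonal
  have hS : ∀ r c : Fin (k + 1), r.val ≤ c.val → S r c = if r = c then -1 else 0 := by
    intro r c hrc
    show M (row r) (col c) = _
    have hr := r.isLt
    have hc := c.isLt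
    by_cases hrk : r.val < k
    · have hrow : row r = ⟨r.val, by omega⟩ := dif_pos hrk
      rw [hrow]
      by_cases hc1 : c.val + 1 < k
      · have hcol : col c = ⟨c.val + 1, by omega⟩ := dif_pos hc1
        rw [hcol]
        have hpat : ((⟨c.val + 1, by omega⟩ : Fin m), (⟨r.val, by omega⟩ : Fin m)) ∈ smearPat k i j :=
          mem_smearPat.2 (Or.inl ⟨by simp; omega, by simp; omega⟩)
        rw [hent _ _ hpat]
        unfold smearEps
        by_cases hreq : r = c
        · subst hreq
          rw [if_pos (mem_ellPos.2 (Or.inl ⟨by simp, by simp; omega⟩)), if_pos rfl]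
        · have hrc' : r.val < c.val := lt_of_le_of_ne hrc (fun h => hreq (Fin.ext h))
          rw [if_neg, if_neg hreq, neg_zero]
          intro hmem
          rcases mem_ellPos.1 hmem with ⟨h1, _⟩ | ⟨h1, _⟩ | ⟨h1, _⟩
          · simp at h1; omega
          · have := congrArg Fin.val h1; simp at this; omega
          · have := congrArg Fin.val h1; simp at this; omega
      · by_cases hc2 : c.val + 1 = k
        · have hcol : col c = j := by
            show (if h : c.val + 1 < k then _ else _) = j
            rw [dif_neg hc1, if_pos hc2]
          rw [hcol]
          have hpat : (j, (⟨r.val, by omega⟩ : Fin m)) ∈ smearPat k i j :=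
            mem_smearPat.2 (Or.inr (Or.inl ⟨Or.inr rfl, by simp; omega⟩))
          rw [hent _ _ hpat]
          unfold smearEps
          by_cases hreq : r = c
          · subst hreq
            rw [if_pos (mem_ellPos.2 (Or.inr (Or.inl ⟨rfl, by simp; omega⟩))), if_pos rfl]
          · have hrc' : r.val < c.val := lt_of_le_of_ne hrc (fun h => hreq (Fin.ext h))
            rw [if_neg, if_neg hreq, neg_zero]
            intro hmem
            rcases mem_ellPos.1 hmem with ⟨_, h2⟩ | ⟨_, h2⟩ | ⟨h1, _⟩
            · omega
            · simp at h2; omega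
            · exact hij' h1.symm
        · have hck : c.val = k := by omega
          have hcol : col c = i := by
            show (if h : c.val + 1 < k then _ else _) = i
            rw [dif_neg hc1, if_neg hc2]
          rw [hcol]
          have hpat : (i, (⟨r.val, by omega⟩ : Fin m)) ∈ smearPat k i j :=
            mem_smearPat.2 (Or.inr (Or.inl ⟨Or.inl rfl, by simp; omega⟩))
          rw [hent _ _ hpat]
          unfold smearEps
          have hreq : r ≠ c := fun h => by rw [h] at hrk; omega
          rw [if_neg, if_neg hreq, neg_zero]
          intro hmem
          rcases mem_ellPos.1 hmem with ⟨_, h2⟩ | ⟨h1, _⟩ | ⟨_, h2⟩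
          · omega
          · exact hij' h1
          · have := congrArg Fin.val h2; simp at this; omega
    · have hrk' : r.val = k := by omega
      have hck : c.val = k := by omega
      have hrow : row r = j := dif_neg hrk
      have hcol : col c = i := by
        show (if h : c.val + 1 < k then _ else _) = i
        rw [dif_neg (by omega), if_neg (by omega)]
      rw [hrow, hcol]
      have hpat : (i, j) ∈ smearPat k i j := mem_smearPat.2 (Or.inr (Or.inr ⟨rfl, rfl⟩))
      rw [hent _ _ hpat]
      unfold smearEps
      rw [if_pos (mem_ellPos.2 (Or.inr (Or.inr ⟨rfl, rfl⟩))), if_pos (Fin.ext (by omega))]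
  have htri : S.BlockTriangular OrderDual.toDual := by
    intro r c hlt
    have hlt' : r < c := by simpa using hlt
    rw [hS r c (le_of_lt hlt'), if_neg (ne_of_lt hlt')]
  have hdet : S.det ≠ 0 := by
    rw [Matrix.det_of_lowerTriangular S htri]
    refine Finset.prod_ne_zero_iff.2 fun r _ => ?_
    rw [hS r r le_rfl, if_pos rfl]
    exact neg_ne_zero.2 one_ne_zero
  have hunit : IsUnit S := (Matrix.isUnit_iff_isUnit_det _).2 (isUnit_iff_ne_zero.2 hdet)
  have hrank : S.rank = k + 1 := by
    rw [Matrix.rank_of_isUnit _ hunit, Fintype.card_fin]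
  calc k + 1 = S.rank := hrank.symm
    _ ≤ M.rank := Matrix.rank_submatrix_le M row col

/-- **ROOT-SMEAR SUM VANISHES ON LEVEL `k`.** For every `M` of rank `≤ k`:
`Σ_e ψ(ℓ(n_e)) ψ(tr(M (1 + n_e))) = 0`. -/
theorem rootSmear_sum_eq_zero (k : ℕ) (i j : Fin m) (hki : k ≤ i.val) (hij : i.val < j.val)
    (M : CMat p m) (hM : M.rank ≤ k) :
    ∑ e : CMat p m, ZMod.stdAddChar (smearEll k i j e) *
        ZMod.stdAddChar (Matrix.trace (M * (1 + smearNil k i j e))) = 0 := by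
  rw [sum_smear_phase]
  by_contra hne
  have hent : ∀ a b : Fin m, (b, a) ∈ smearPat k i j → M a b = -smearEps k i j b a := by
    intro a b hp
    have hzero : M a b + smearEps k i j b a = 0 := by
      by_contra hM'
      apply hne
      apply mul_eq_zero_of_right
      apply Finset.prod_eq_zero (Finset.mem_univ a)
      apply Finset.prod_eq_zero (Finset.mem_univ b)
      rw [if_pos hp, if_neg hM']
    exact eq_neg_of_add_eq_zero_left hzero
  have := succ_le_rank_of_smear_entries k i j hki hij M hent
  omega

/-- **The twisted sum of a level-`k` function over the pattern group vanishes.** -/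
theorem rootSmear_fourierMat_sum_eq_zero (k : ℕ) (i j : Fin m) (hki : k ≤ i.val) (hij : i.val < j.val)
    (c : CMat p m → ℂ) (hc : ∀ M : CMat p m, k < M.rank → c M = 0) :
    ∑ e : CMat p m, ZMod.stdAddChar (smearEll k i j e) * fourierMat c (1 + smearNil k i j e) = 0 := by
  unfold fourierMat
  simp_rw [Finset.mul_sum]
  rw [Finset.sum_comm]
  refine Finset.sum_eq_zero fun M _ => ?_
  have : ∀ e : CMat p m, ZMod.stdAddChar (smearEll k i j e) *
      (c M * ZMod.stdAddChar (Matrix.trace (M * (1 + smearNil k i j e)))) =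
      c M * (ZMod.stdAddChar (smearEll k i j e) *
        ZMod.stdAddChar (Matrix.trace (M * (1 + smearNil k i j e)))) := fun e => by ring
  simp_rw [this]
  rw [← Finset.mul_sum]
  by_cases hr : M.rank ≤ k
  · rw [rootSmear_sum_eq_zero k i j hki hij M hr, mul_zero]
  · rw [hc M (by omega), zero_mul]

/-- **NO LEVEL-`k` IDENTITY TEST ON A SET CONTAINING THE ROOT-SMEAR PATTERN GROUP.** If `S ⊆ M_m(𝔽_p)`
contains every point `1 + n_e` of `Q`, then no Fourier table supported in rank `≤ k` gives a function that
is `1` at `1` and `0` on `S ∖ {1}`. -/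
theorem no_idTest_of_rootSmear (k : ℕ) (i j : Fin m) (hki : k ≤ i.val) (hij : i.val < j.val)
    (S : Set (CMat p m)) (hS : ∀ e : CMat p m, 1 + smearNil k i j e ∈ S)
    (c : CMat p m → ℂ) (hc : ∀ M : CMat p m, k < M.rank → c M = 0)
    (h1 : fourierMat c 1 = 1) (h0 : ∀ s ∈ S, s ≠ 1 → fourierMat c s = 0) : False := by
  have hsum := rootSmear_fourierMat_sum_eq_zero k i j hki hij c hc
  -- each term is `[n_e = 0]`
  have hval : ∀ e : CMat p m, ZMod.stdAddChar (smearEll k i j e) * fourierMat c (1 + smearNil k i j e) =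
      if smearNil k i j e = 0 then 1 else 0 := by
    intro e
    by_cases he : smearNil k i j e = 0
    · have hℓ : smearEll k i j e = 0 := by
        unfold smearEll
        refine Finset.sum_eq_zero fun a _ => Finset.sum_eq_zero fun b _ => ?_
        by_cases hl : (b, a) ∈ ellPos k i j
        · rw [if_pos hl]
          have := congrFun (congrFun he b) a
          simp only [smearNil, Matrix.of_apply, if_pos (ellPos_imp_smearPat hl), Matrix.zero_apply] at this
          exact this
        · rw [if_neg hl]
      rw [if_pos he, he, add_zero, hℓ, AddChar.map_zero_eq_one, h1, one_mul]
    · have hne1 : (1 : CMat p m) + smearNil k i j e ≠ 1 := fun h => he (by simpa using h)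
      rw [if_neg he, h0 _ (hS e) hne1, mul_zero]
  simp_rw [hval] at hsum
  rw [Finset.sum_ite, Finset.sum_const_zero, add_zero, Finset.sum_const, nsmul_eq_mul, mul_one] at hsum
  have hpos : 0 < (Finset.univ.filter fun e : CMat p m => smearNil k i j e = 0).card :=
    Finset.card_pos.2 ⟨0, by simp [smearNil]; rfl⟩
  exact absurd hsum (Nat.cast_ne_zero.2 hpos.ne')

end Summit.MatrixMultiplication.MatrixMultiplication.Theorems.SubgroupIdentityDesigns.Negative

end
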